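import Summits.KontsevichZagierPeriods.KontsevichZagierPeriods.Theorems.KzOnePeriodsG2SPlane

/-!
# G2S derivations, part 2: the involution `σ(x, y) = (−x, y)` and paths on `C_{a,b,c}`

Sub-problem `KzOnePeriods` ([cite: HuberWustholz2022, Thm 13.3 (2) p.121]); helper lane of the
kz1p derivation modules (cell pub-kz1p, seat 2, gen 16); part 1 is `KzOnePeriodsG2SPlane`.

* (R4) + (R1) for `σ`: `σ` maps `C` to itself (`sig_mem`), `σ^*θ_P = −θ_{P(−x)}` exactly
  (`formPullback_sig_theta`), every `C¹` path has a `σ`-image path (`exists_sigmaPath`), and for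
  `P` even `[(C, θ_P, γ)] + [(C, θ_P, σ∘γ)] ∈ ⟨(R1)–(R5)⟩_ℚ̄` (`span_sigma_even`), whence
  `∫_γ P dx/2y + ∫_{σ∘γ} P dx/2y = 0` by soundness (`relation_sigma_even`,
  `evalCombination_eq_zero_of_isElementaryRelation`).  This is kz1p's convention
  `c_jk^- := σ_* c_jk^+` turned into a derivation.
* Paths (non-vacuity of the relation theorems): `exists_constPath`; `exists_realArcPath` — the real
  arc `(x(t), s√f(x(t)))`, `x(t)` affine, on the outer branch `x² > r₃` of `f = Π_j (x² − r_j)`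
  between two real algebraic points of `C`, is a `C¹` path on `C` (tree `CurvePath`).
[cite: HuberWustholz2022, §13.1 (A)–(B) p.120, Thm 13.3 (2) p.121]

No new axioms; no statements of the programme are cited.
-/

noncomputable section

open MvPolynomial Set Complex Filter Topology
open Literature.NumberTheory.Transcendental Literature.NumberTheory.Transcendental.CurvePeriods
open Summit.KontsevichZagierPeriods.KzOnePeriods.E1Derivation

namespace Summit.KontsevichZagierPeriods.KzOnePeriods.G2SDerivation

local notation3 "InSpanRel " c:arg => ∃ (k : ℕ) (ρ : Fin k → (PeriodSymbol →₀ ℂ))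
  (a : Fin k → ℂ), (∀ l, IsElementaryRelation (ρ l)) ∧ (∀ l, IsAlgebraic ℚ (a l)) ∧
    c = ∑ l, a l • ρ l

/-- The symbol `(Z, ω, γ)` as an element of the formal period space. -/
local notation3 (prettyPrint := false) "Sy[" Z ", " hZ ", " ω ", " h ", " γ "]" =>
  (Finsupp.single (⟨Z, hZ, ω, h, γ⟩ : PeriodSymbol) (1 : ℂ) : PeriodSymbol →₀ ℂ)

/-- The period `∫_γ ω` of the symbol `(Z, ω, γ)`. -/
local notation3 (prettyPrint := false) "Pe[" Z ", " hZ ", " ω ", " h ", " γ "]" =>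
  PeriodSymbol.period (⟨Z, hZ, ω, h, γ⟩ : PeriodSymbol)

/-- The even sextic `f = x⁶ + a x⁴ + b x² + c ∈ ℂ[x, y]`. -/
local notation3 (prettyPrint := false) "fS[" a ", " b ", " c "]" =>
  ((X 0 : MvPolynomial (Fin 2) ℂ) ^ 6 + C a * X 0 ^ 4 + C b * X 0 ^ 2 + C c)

/-- The affine plane model `C_{a,b,c} = {y² = f(x)} ⊂ 𝔸²` of the genus-2 curve (minus `∞±`). -/
local notation3 (prettyPrint := false) "Cpl[" a ", " b ", " c "]" =>
  (⟨2, 1, ![(X 1 : MvPolynomial (Fin 2) ℂ) ^ 2 - fS[a, b, c]]⟩ : CurveData)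

/-- The polynomial `Σ_k π_k x^k ∈ ℂ[x, y]` with coefficient vector `π`. -/
local notation3 (prettyPrint := false) "Pol[" π "]" =>
  (∑ k, C (π k) * (X 0 : MvPolynomial (Fin 2) ℂ) ^ (k : ℕ))

/-- The even polynomial `U = Σ_{k<3} μ_k x^{2k}` (Bézout cofactor of `f`). -/
local notation3 (prettyPrint := false) "Upol[" μ "]" =>
  (∑ k : Fin 3, C (μ k) * (X 0 : MvPolynomial (Fin 2) ℂ) ^ (2 * (k : ℕ)))

/-- The odd polynomial `V = Σ_{k<3} ν_k x^{2k+1}` (Bézout cofactor of `f′`). -/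
local notation3 (prettyPrint := false) "Vpol[" ν "]" =>
  (∑ k : Fin 3, C (ν k) * (X 0 : MvPolynomial (Fin 2) ℂ) ^ (2 * (k : ℕ) + 1))

/-- `θ[μ, ν, π] = (½ P U y) dx + (P V) dy`, the polynomial representative of `P(x) dx/(2y)`. -/
local notation3 (prettyPrint := false) "θ[" μ ", " ν ", " π "]" =>
  (![C (1 / 2 : ℂ) * Pol[π] * Upol[μ] * X 1, Pol[π] * Vpol[ν]] :
    Fin 2 → MvPolynomial (Fin 2) ℂ)

/-- The involution `σ(x, y) = (−x, y)` of the plane, as a polynomial map. -/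
local notation3 (prettyPrint := false) "sig" => (![-X 0, X 1] : Fin 2 → MvPolynomial (Fin 2) ℂ)

/-- The Bézout identity `U f + V f′ = 1` for `U = Σ μ_k x^{2k}`, `V = Σ ν_k x^{2k+1}` (scalar form). -/
local notation3 (prettyPrint := false) "Bez[" a ", " b ", " c ", " μ ", " ν "]" =>
  (∀ x : ℂ, (∑ k : Fin 3, μ k * x ^ (2 * (k : ℕ))) * (x ^ 6 + a * x ^ 4 + b * x ^ 2 + c) +
    (∑ k : Fin 3, ν k * x ^ (2 * (k : ℕ) + 1)) * (6 * x ^ 5 + 4 * a * x ^ 3 + 2 * b * x) = 1)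

variable {a b c : ℂ}

/-! ### (R4) + (R1): the antisymmetry `σ^* θ_P = −θ_{P(−x)}` under `σ(x, y) = (−x, y)` -/

/-- The polynomial map `σ = (−x, y)` has algebraic coefficients. -/
theorem hasAlgCoeffs_sig : ∀ j, HasAlgCoeffs (sig j) := by
  intro j
  fin_cases j
  · simpa using (hasAlgCoeffs_X (n := 2) 0).neg
  · simpa using hasAlgCoeffs_X (n := 2) 1

/-- `σ(x, y) = (−x, y)` maps `C_{a,b,c}` to itself (`f` is even). -/
theorem sig_mem {z : Fin 2 → ℂ} (hz : z ∈ Cpl[a, b, c].points) :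
    (fun j => eval z (sig j)) ∈ Cpl[a, b, c].points := by
  rw [mem_points_iff] at hz ⊢
  simp only [Matrix.cons_val_zero, Matrix.cons_val_one, map_neg, eval_X]
  rw [hz]
  ring

/-- `σ^* P = P(−x)`: substituting `σ` into `Pol[π]` flips the signs of the odd coefficients. -/
theorem bind₁_sig_Pol {N : ℕ} (π : Fin N → ℂ) :
    bind₁ sig Pol[π] = Pol[fun k : Fin N => (-1) ^ (k : ℕ) * π k] := by
  simp only [map_sum, map_mul, bind₁_C_right, map_pow, bind₁_X_right, Matrix.cons_val_zero]
  refine Finset.sum_congr rfl fun k _ => ?_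
  rw [map_neg, map_one, neg_pow]
  ring

/-- `σ^* U = U` (`U` is even). -/
theorem bind₁_sig_Upol (μ : Fin 3 → ℂ) : bind₁ sig Upol[μ] = Upol[μ] := by
  simp only [map_sum, map_mul, bind₁_C_right, map_pow, bind₁_X_right, Matrix.cons_val_zero]
  refine Finset.sum_congr rfl fun k _ => ?_
  rw [Even.neg_pow (even_two_mul _)]

/-- `σ^* V = −V` (`V` is odd). -/
theorem bind₁_sig_Vpol (ν : Fin 3 → ℂ) : bind₁ sig Vpol[ν] = -Vpol[ν] := by
  simp only [map_sum, map_mul, bind₁_C_right, map_pow, bind₁_X_right, Matrix.cons_val_zero]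
  rw [← Finset.sum_neg_distrib]
  refine Finset.sum_congr rfl fun k _ => ?_
  rw [Odd.neg_pow (odd_two_mul_add_one _)]
  ring

/-- `σ^* θ[μ, ν, π] = −θ[μ, ν, π⁻]` with `π⁻_k = (−1)^k π_k`, i.e. `σ^*(P(x) dx/2y) = −P(−x) dx/2y`. -/
theorem formPullback_sig_theta (μ ν : Fin 3 → ℂ) {N : ℕ} (π : Fin N → ℂ) :
    formPullback sig θ[μ, ν, π] = (-1 : ℂ) • θ[μ, ν, fun k : Fin N => (-1) ^ (k : ℕ) * π k] := by
  funext i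
  rw [formPullback_two, Pi.smul_apply, smul_eq_C_mul]
  simp only [Matrix.cons_val_zero, Matrix.cons_val_one, map_mul, bind₁_C_right, bind₁_X_right]
  rw [bind₁_sig_Pol, bind₁_sig_Upol, bind₁_sig_Vpol]
  simp only [map_mul, map_pow, map_neg, map_one]
  fin_cases i
  · simp only [Fin.zero_eta, Matrix.cons_val_zero, pderiv_X_self,
      pderiv_X_of_ne (show (1 : Fin 2) ≠ 0 by decide)]
    ring
  · simp only [Fin.mk_one, Matrix.cons_val_zero, Matrix.cons_val_one, pderiv_X_self,
      pderiv_X_of_ne (show (0 : Fin 2) ≠ 1 by decide)]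
    ring

/-- The image `σ ∘ γ` of a path `γ` on `C_{a,b,c}` is again a `C¹` path on `C_{a,b,c}` with
algebraic endpoints. -/
theorem exists_sigmaPath (γ : CurvePath Cpl[a, b, c]) :
    ∃ γ' : CurvePath Cpl[a, b, c], ∀ t, γ'.toFun t = ![-(γ.toFun t 0), γ.toFun t 1] := by
  obtain ⟨γ', h⟩ := exists_imagePath (Z := Cpl[a, b, c]) (Z' := Cpl[a, b, c]) sig
    hasAlgCoeffs_sig (fun z hz => sig_mem hz) γ
  refine ⟨γ', fun t => ?_⟩
  rw [h t]
  funext j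
  fin_cases j <;> simp

/-- The sign-flipped coefficient vector `((−1)^k π_k)_k` is algebraic. -/
theorem isAlgebraic_signed {N : ℕ} {π : Fin N → ℂ} (hπ : ∀ k, IsAlgebraic ℚ (π k)) :
    ∀ k : Fin N, IsAlgebraic ℚ ((-1) ^ (k : ℕ) * π k) :=
  fun k => (isAlgebraic_one.neg.pow _).mul (hπ k)

/-- **(R4) + (R1) for `σ`.**  For a path `γ` and its image `γ' = σ ∘ γ`:
`(C, θ_P, γ') + (C, θ_{P(−x)}, γ) ∈ RelF`. -/
theorem span_sigma (ha : IsAlgebraic ℚ a) (hb : IsAlgebraic ℚ b) (hc : IsAlgebraic ℚ c)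
    {μ ν : Fin 3 → ℂ} (hμ : ∀ k, IsAlgebraic ℚ (μ k)) (hν : ∀ k, IsAlgebraic ℚ (ν k))
    (hbez : Bez[a, b, c, μ, ν]) {N : ℕ} {π : Fin N → ℂ} (hπ : ∀ k, IsAlgebraic ℚ (π k))
    {γ γ' : CurvePath Cpl[a, b, c]}
    (hγ' : ∀ t ∈ Icc (0 : ℝ) 1, γ'.toFun t = ![-(γ.toFun t 0), γ.toFun t 1]) :
    InSpanRel (Sy[Cpl[a, b, c], smooth ha hb hc hbez, θ[μ, ν, π], hasAlgCoeffs_theta hμ hν hπ, γ'] +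
      Sy[Cpl[a, b, c], smooth ha hb hc hbez, θ[μ, ν, fun k : Fin N => (-1) ^ (k : ℕ) * π k],
        hasAlgCoeffs_theta hμ hν (isAlgebraic_signed hπ), γ]) := by
  have hγ'' : ∀ t ∈ Icc (0 : ℝ) 1, γ'.toFun t = fun j => eval (γ.toFun t) (sig j) := by
    intro t ht
    rw [hγ' t ht]
    funext j
    fin_cases j <;> simp
  obtain ⟨k, ρ, w, hρ, hw, hs⟩ := span_image_of_formPullback_eq (smooth ha hb hc hbez)
    (smooth ha hb hc hbez) sig hasAlgCoeffs_sig (fun z hz => sig_mem hz) θ[μ, ν, π]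
    (hasAlgCoeffs_theta hμ hν hπ) θ[μ, ν, fun k : Fin N => (-1) ^ (k : ℕ) * π k]
    (hasAlgCoeffs_theta hμ hν (isAlgebraic_signed hπ)) (u := -1) isAlgebraic_one.neg
    (formPullback_sig_theta μ ν π) hγ''
  exact ⟨k, ρ, w, hρ, hw, by rw [← hs, neg_one_smul, sub_neg_eq_add]⟩

/-- **(R4) + (R1) for `σ`, even `P`.**  If `P(−x) = P(x)` then `(C, θ_P, γ) + (C, θ_P, σ ∘ γ) ∈ RelF`:
the formal version of `∫_{σ_* γ} P dx/2y = −∫_γ P dx/2y`. -/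
theorem span_sigma_even (ha : IsAlgebraic ℚ a) (hb : IsAlgebraic ℚ b) (hc : IsAlgebraic ℚ c)
    {μ ν : Fin 3 → ℂ} (hμ : ∀ k, IsAlgebraic ℚ (μ k)) (hν : ∀ k, IsAlgebraic ℚ (ν k))
    (hbez : Bez[a, b, c, μ, ν]) {N : ℕ} {π : Fin N → ℂ} (hπ : ∀ k, IsAlgebraic ℚ (π k))
    (heven : ∀ k : Fin N, (-1 : ℂ) ^ (k : ℕ) * π k = π k) {γ γ' : CurvePath Cpl[a, b, c]}
    (hγ' : ∀ t ∈ Icc (0 : ℝ) 1, γ'.toFun t = ![-(γ.toFun t 0), γ.toFun t 1]) :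
    InSpanRel (Sy[Cpl[a, b, c], smooth ha hb hc hbez, θ[μ, ν, π], hasAlgCoeffs_theta hμ hν hπ, γ] +
      Sy[Cpl[a, b, c], smooth ha hb hc hbez, θ[μ, ν, π], hasAlgCoeffs_theta hμ hν hπ, γ']) := by
  have h := span_sigma ha hb hc hμ hν hbez hπ hγ'
  have hθ : θ[μ, ν, fun k : Fin N => (-1) ^ (k : ℕ) * π k] = θ[μ, ν, π] := by
    simp only [heven]
  rw [PeriodSymbol.mk_eq_mk (smooth ha hb hc hbez) (hasAlgCoeffs_theta hμ hν (isAlgebraic_signed hπ))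
    (hasAlgCoeffs_theta hμ hν hπ) γ hθ, add_comm] at h
  exact h

/-- **Period identity for `σ`, even `P`.**  `∫_γ θ_P + ∫_{σ∘γ} θ_P = 0`. -/
theorem relation_sigma_even (ha : IsAlgebraic ℚ a) (hb : IsAlgebraic ℚ b) (hc : IsAlgebraic ℚ c)
    {μ ν : Fin 3 → ℂ} (hμ : ∀ k, IsAlgebraic ℚ (μ k)) (hν : ∀ k, IsAlgebraic ℚ (ν k))
    (hbez : Bez[a, b, c, μ, ν]) {N : ℕ} {π : Fin N → ℂ} (hπ : ∀ k, IsAlgebraic ℚ (π k))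
    (heven : ∀ k : Fin N, (-1 : ℂ) ^ (k : ℕ) * π k = π k) {γ γ' : CurvePath Cpl[a, b, c]}
    (hγ' : ∀ t ∈ Icc (0 : ℝ) 1, γ'.toFun t = ![-(γ.toFun t 0), γ.toFun t 1]) :
    Pe[Cpl[a, b, c], smooth ha hb hc hbez, θ[μ, ν, π], hasAlgCoeffs_theta hμ hν hπ, γ] +
      Pe[Cpl[a, b, c], smooth ha hb hc hbez, θ[μ, ν, π], hasAlgCoeffs_theta hμ hν hπ, γ'] = 0 := by
  obtain ⟨k, ρ, w, hρ, hw, hs⟩ := span_sigma_even ha hb hc hμ hν hbez hπ heven hγ'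
  have h0 := evalCombination_eq_zero_of_isElementaryRelation ρ w hρ
  rw [← hs, evalCombination_add, evalCombination_single, evalCombination_single, one_mul,
    one_mul] at h0
  exact h0

/-! ### Paths on `C_{a,b,c}`: the relation theorems are not vacuous -/

/-- The constant (closed) path at an algebraic point of the curve. -/
theorem exists_constPath {z : Fin 2 → ℂ} (hz : z ∈ Cpl[a, b, c].points)
    (halg : ∀ i, IsAlgebraic ℚ (z i)) : ∃ γ : CurvePath Cpl[a, b, c], ∀ t, γ.toFun t = z :=
  ⟨{ toFun := fun _ => z
     contDiffOn := contDiffOn_const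
     mem_points := fun _ _ => hz
     algebraic_zero := halg
     algebraic_one := halg }, fun _ => rfl⟩

/-- On the outer real branches `x² > r₃ ≥ r₁, r₂`: `f(x) = (x² − r₁)(x² − r₂)(x² − r₃) > 0`. -/
theorem outer_pos {r₁ r₂ r₃ X : ℝ} (h₁ : r₁ ≤ r₃) (h₂ : r₂ ≤ r₃) (hX : r₃ < X ^ 2) :
    0 < (X ^ 2 - r₁) * (X ^ 2 - r₂) * (X ^ 2 - r₃) :=
  mul_pos (mul_pos (by linarith) (by linarith)) (by linarith)

/-- The segment between two points `x₀, x₁` of the same sign with `x₀², x₁² > r` stays in `x² > r`. -/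
theorem segment_sq_gt {x₀ x₁ r : ℝ} (hx₀ : r < x₀ ^ 2) (hx₁ : r < x₁ ^ 2) (hxx : 0 < x₀ * x₁)
    {t : ℝ} (ht : t ∈ Icc (0 : ℝ) 1) : r < (x₀ + t * (x₁ - x₀)) ^ 2 := by
  obtain ⟨ht0, ht1⟩ := ht
  rcases pos_and_pos_or_neg_and_neg_of_mul_pos hxx with ⟨h0, h1⟩ | ⟨h0, h1⟩
  · rcases le_total x₀ x₁ with h01 | h01
    · have hge : x₀ ≤ x₀ + t * (x₁ - x₀) := by nlinarith
      nlinarith [mul_nonneg (sub_nonneg.2 hge) (by linarith : 0 ≤ x₀ + t * (x₁ - x₀) + x₀)]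
    · have hge : x₁ ≤ x₀ + t * (x₁ - x₀) := by nlinarith
      nlinarith [mul_nonneg (sub_nonneg.2 hge) (by linarith : 0 ≤ x₀ + t * (x₁ - x₀) + x₁)]
  · rcases le_total x₀ x₁ with h01 | h01
    · have hle : x₀ + t * (x₁ - x₀) ≤ x₁ := by nlinarith
      nlinarith [mul_nonneg (sub_nonneg.2 hle) (by linarith : 0 ≤ -(x₀ + t * (x₁ - x₀)) - x₁)]
    · have hle : x₀ + t * (x₁ - x₀) ≤ x₀ := by nlinarith
      nlinarith [mul_nonneg (sub_nonneg.2 hle) (by linarith : 0 ≤ -(x₀ + t * (x₁ - x₀)) - x₀)]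

/-- `s·√g = y` when `y² = g`, `s = ±1` and `s y > 0` (the sign of the branch). -/
theorem sign_mul_sqrt_eq {s y g : ℝ} (hs : s = 1 ∨ s = -1) (hy : y ^ 2 = g) (hsy : 0 < s * y) :
    s * √g = y := by
  rw [← hy, Real.sqrt_sq_eq_abs]
  rcases hs with rfl | rfl
  · rw [one_mul] at hsy ⊢
    exact abs_of_pos hsy
  · rw [abs_of_neg (by linarith), neg_one_mul, neg_neg]

/-- **Real arcs on the outer branches.**  For a kz1p curve `y² = f(x) = (x² − r₁)(x² − r₂)(x² − r₃)`
(`r₃` the largest root of `g`) and real algebraic points `(x₀, y₀)`, `(x₁, y₁)` on the same outer real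
branch (`x₀ x₁ > 0`, `x₀², x₁² > r₃`, `sign y₀ = sign y₁ = s`), the graph
`t ↦ (x(t), s √f(x(t)))`, `x(t) = x₀ + t (x₁ − x₀)`, is a `C¹` path on `C_{a,b,c}` from `(x₀, y₀)` to
`(x₁, y₁)` — the path class `g: Q → P` of the corpus case G2-06. -/
theorem exists_realArcPath {A B C₀ r₁ r₂ r₃ x₀ y₀ x₁ y₁ s : ℝ} (ha : a = A) (hb : b = B)
    (hc : c = C₀)
    (hfac : ∀ X : ℝ, X ^ 6 + A * X ^ 4 + B * X ^ 2 + C₀ = (X ^ 2 - r₁) * (X ^ 2 - r₂) * (X ^ 2 - r₃))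
    (h₁ : r₁ ≤ r₃) (h₂ : r₂ ≤ r₃) (hx₀ : r₃ < x₀ ^ 2) (hx₁ : r₃ < x₁ ^ 2) (hxx : 0 < x₀ * x₁)
    (hs : s = 1 ∨ s = -1) (hy₀ : y₀ ^ 2 = x₀ ^ 6 + A * x₀ ^ 4 + B * x₀ ^ 2 + C₀)
    (hsy₀ : 0 < s * y₀) (hy₁ : y₁ ^ 2 = x₁ ^ 6 + A * x₁ ^ 4 + B * x₁ ^ 2 + C₀) (hsy₁ : 0 < s * y₁)
    (hx₀a : IsAlgebraic ℚ (x₀ : ℂ)) (hy₀a : IsAlgebraic ℚ (y₀ : ℂ)) (hx₁a : IsAlgebraic ℚ (x₁ : ℂ))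
    (hy₁a : IsAlgebraic ℚ (y₁ : ℂ)) :
    ∃ γ : CurvePath Cpl[a, b, c], γ.toFun 0 = ![(x₀ : ℂ), (y₀ : ℂ)] ∧
      γ.toFun 1 = ![(x₁ : ℂ), (y₁ : ℂ)] ∧
      ∀ t, γ.toFun t = ![((x₀ + t * (x₁ - x₀) : ℝ) : ℂ),
        ((s * √((x₀ + t * (x₁ - x₀)) ^ 6 + A * (x₀ + t * (x₁ - x₀)) ^ 4 +
          B * (x₀ + t * (x₁ - x₀)) ^ 2 + C₀) : ℝ) : ℂ)] := by
  subst ha hb hc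
  obtain ⟨φ, hφ⟩ : ∃ φ : ℝ → Fin 2 → ℂ, φ = fun t => ![((x₀ + t * (x₁ - x₀) : ℝ) : ℂ),
      ((s * √((x₀ + t * (x₁ - x₀)) ^ 6 + A * (x₀ + t * (x₁ - x₀)) ^ 4 +
        B * (x₀ + t * (x₁ - x₀)) ^ 2 + C₀) : ℝ) : ℂ)] := ⟨_, rfl⟩
  have hs2 : s ^ 2 = 1 := by rcases hs with rfl | rfl <;> norm_num
  have hgpos : ∀ t ∈ Icc (0 : ℝ) 1, 0 < (x₀ + t * (x₁ - x₀)) ^ 6 + A * (x₀ + t * (x₁ - x₀)) ^ 4 +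
      B * (x₀ + t * (x₁ - x₀)) ^ 2 + C₀ := fun t ht => by
    rw [hfac]
    exact outer_pos h₁ h₂ (segment_sq_gt hx₀ hx₁ hxx ht)
  have h0 : φ 0 = ![(x₀ : ℂ), (y₀ : ℂ)] := by
    rw [hφ]
    simp only [zero_mul, add_zero]
    rw [sign_mul_sqrt_eq hs hy₀ hsy₀]
  have h1 : φ 1 = ![(x₁ : ℂ), (y₁ : ℂ)] := by
    rw [hφ]
    simp only [one_mul, add_sub_cancel]
    rw [sign_mul_sqrt_eq hs hy₁ hsy₁]
  have hpoly : ContDiff ℝ 1 fun t : ℝ => (x₀ + t * (x₁ - x₀)) ^ 6 + A * (x₀ + t * (x₁ - x₀)) ^ 4 +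
      B * (x₀ + t * (x₁ - x₀)) ^ 2 + C₀ := by fun_prop
  have hlin : ContDiff ℝ 1 fun t : ℝ => x₀ + t * (x₁ - x₀) := by fun_prop
  have e0 : (fun t : ℝ => ((x₀ + t * (x₁ - x₀) : ℝ) : ℂ)) =
      ⇑Complex.ofRealCLM ∘ fun t : ℝ => x₀ + t * (x₁ - x₀) := by
    funext t
    simp
  have e1 : (fun t : ℝ => ((s * √((x₀ + t * (x₁ - x₀)) ^ 6 + A * (x₀ + t * (x₁ - x₀)) ^ 4 +
      B * (x₀ + t * (x₁ - x₀)) ^ 2 + C₀) : ℝ) : ℂ)) =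
      ⇑Complex.ofRealCLM ∘ fun t : ℝ => s * √((x₀ + t * (x₁ - x₀)) ^ 6 +
        A * (x₀ + t * (x₁ - x₀)) ^ 4 + B * (x₀ + t * (x₁ - x₀)) ^ 2 + C₀) := by
    funext t
    simp
  refine ⟨{ toFun := φ
            contDiffOn := ?_
            mem_points := ?_
            algebraic_zero := ?_
            algebraic_one := ?_ }, h0, h1, fun t => by show φ t = _; rw [hφ]⟩
  · rw [contDiffOn_pi]
    intro j
    rw [hφ]
    fin_cases j
    · simp only [Fin.zero_eta, Matrix.cons_val_zero]
      rw [e0]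
      exact (Complex.ofRealCLM.contDiff.comp hlin).contDiffOn
    · simp only [Fin.mk_one, Matrix.cons_val_one, Matrix.cons_val_zero]
      rw [e1]
      exact Complex.ofRealCLM.contDiff.comp_contDiffOn
        (contDiffOn_const.mul ((hpoly.contDiffOn).sqrt fun t ht => (hgpos t ht).ne'))
  · intro t ht
    rw [mem_points_iff, hφ]
    simp only [Matrix.cons_val_zero, Matrix.cons_val_one]
    have h : (s * √((x₀ + t * (x₁ - x₀)) ^ 6 + A * (x₀ + t * (x₁ - x₀)) ^ 4 +
        B * (x₀ + t * (x₁ - x₀)) ^ 2 + C₀)) ^ 2 = (x₀ + t * (x₁ - x₀)) ^ 6 +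
        A * (x₀ + t * (x₁ - x₀)) ^ 4 + B * (x₀ + t * (x₁ - x₀)) ^ 2 + C₀ := by
      rw [mul_pow, hs2, one_mul, Real.sq_sqrt (hgpos t ht).le]
    exact_mod_cast h
  · intro i
    rw [h0]
    fin_cases i
    · simpa using hx₀a
    · simpa using hy₀a
  · intro i
    rw [h1]
    fin_cases i
    · simpa using hx₁a
    · simpa using hy₁a

end Summit.KontsevichZagierPeriods.KzOnePeriods.G2SDerivation

end
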